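import Summits.RiemannHypothesis.RiemannHypothesis.Theorems.HandoffDodgerSmallHorizon
import Summits.RiemannHypothesis.RiemannHypothesis.Theorems.HandoffDodgerSmallProfile
import HarnessLib

/-!
# HANDOFF — THIRD SLAB (1): horizon facts for `12500 ≤ e^{2b} ≤ 25000` (rh-explicit, D-0040 WEIL column prover seat handoff-prove-2 gen13, ATTEMPT-23)

RH-FREE. HONEST FRAMING: nothing here bears on the truth of RH; this is part (1) of the discharge of the hypotheses of
`HandoffDodgerExplicit.dodger_witness_explicit` on the THIRD SLAB `12500 ≤ q < 25000` (`12499 ≤ e^{2b} ≤ 25000`), below this seat's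
threshold `q₀ = 25000` of `HandoffDodgerSlabTwo*` (ATTEMPT-23 §5), towards the gap-blind RH-free upper clause
`a*(S_q) < (log q⁺)/2` for every prime `q ≥ 12500` via the SHARP witness `dodger_witness_explicit_sharp` (ATTEMPT-23 §7: 166 more twins
of the WEIL route's wall 19185). The schedule on this slab is CONSTANT: `y = 38`, `N₁ = 46`, `n = q³`, `C = 1/5`, `b = L/2 − ε`.  This file: the sizes of
`T₀ = 2πe^{1+2b}`, `s₁(T₀)`, `T*`, `k′`, `T′ = πk′/b`, `W`, `cI`, `pL`, `pU` with NUMERIC constants valid on the slab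
(`4.715 ≤ b ≤ 5.07`, `213000 ≤ T′`, `T′³/56.7 ≤ cI`, `T′³/28.36 ≤ pL`, `pU ≤ 1.615·T′³`, …).

References: this track (ATTEMPT-16 §1, ATTEMPT-19 §8, ATTEMPT-21 §2, ATTEMPT-23 §2/§5).
-/

set_option linter.dupNamespace false

noncomputable section

open Real

namespace Summit.RiemannHypothesis.RiemannHypothesis.Theorems.Handoff

/-! ## Numerical floor and ceiling of the slab -/

/-- `e^{9.43} ≤ 12499` and `25000 ≤ e^{10.14}`. [folklore] -/
theorem exp_slabThree_bounds : Real.exp (943 / 100) ≤ 12499 ∧ (25000 : ℝ) ≤ Real.exp (507 / 50) := by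
  have hgt := Real.exp_one_gt_d9
  have hlt := Real.exp_one_lt_d9
  have h0 := Real.exp_pos 1
  have h10e : Real.exp 1 ^ 10 = Real.exp 10 := by exact_mod_cast Real.exp_one_pow 10
  constructor
  · have h9e : Real.exp 1 ^ 9 = Real.exp 9 := by exact_mod_cast Real.exp_one_pow 9
    have e1 : Real.exp (943 / 100) = Real.exp 1 ^ 9 * Real.exp (43 / 100) := by
      rw [h9e, ← Real.exp_add]; norm_num
    have h10 : Real.exp 1 ^ 9 ≤ 2.7182818286 ^ 9 := pow_le_pow_left₀ h0.le hlt.le 9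
    have h3 : Real.exp (43 / 100) ≤ 1.5373 := by
      have := Real.exp_bound' (x := 43 / 100) (by norm_num) (by norm_num) (n := 5) (by norm_num)
      simp only [Finset.sum_range_succ, Finset.sum_range_zero, Nat.factorial] at this
      norm_num at this
      linarith
    rw [e1]
    calc Real.exp 1 ^ 9 * Real.exp (43 / 100) ≤ 2.7182818286 ^ 9 * 1.5373 :=
          mul_le_mul h10 h3 (Real.exp_pos _).le (by positivity)
      _ ≤ 12499 := by norm_num
  · have e1 : Real.exp (507 / 50) = Real.exp 1 ^ 10 * Real.exp (7 / 50) := by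
      rw [h10e, ← Real.exp_add]; norm_num
    have h10 : (2.7182818283 : ℝ) ^ 10 ≤ Real.exp 1 ^ 10 := pow_le_pow_left₀ (by norm_num) hgt.le 10
    have h3 : (1.1498 : ℝ) ≤ Real.exp (7 / 50) := by
      have := Real.quadratic_le_exp_of_nonneg (show (0 : ℝ) ≤ 7 / 50 by norm_num); norm_num at this; linarith
    rw [e1]
    calc (25000 : ℝ) ≤ 2.7182818283 ^ 10 * 1.1498 := by norm_num
      _ ≤ Real.exp 1 ^ 10 * Real.exp (7 / 50) := mul_le_mul h10 h3 (by norm_num) (by positivity)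

/-- On the third slab `12499 ≤ e^{2b} ≤ 25000`: `4.715 ≤ b ≤ 5.07`. [this track, ATTEMPT-23 §7] -/
theorem slabThree_b_bounds {b : ℝ} (he : 12499 ≤ Real.exp (2 * b)) (he' : Real.exp (2 * b) ≤ 25000) :
    943 / 200 ≤ b ∧ b ≤ 507 / 100 := by
  obtain ⟨h1, h2⟩ := exp_slabThree_bounds
  constructor
  · by_contra h
    have : Real.exp (2 * b) < Real.exp (943 / 100) := Real.exp_lt_exp.2 (by linarith)
    linarith
  · by_contra h
    have : Real.exp (507 / 50) < Real.exp (2 * b) := Real.exp_lt_exp.2 (by linarith)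
    linarith

/-! ## Basic sizes -/

/-- On the third slab: `e ≤ T₀`, `17.07e^{2b} ≤ T₀ ≤ 17.08e^{2b}`, `213300 ≤ T₀ ≤ 427000`, `10 ≤ s₁(T₀) ≤ 11.52`.
[this track, ATTEMPT-23 §7] -/
theorem slabThree_horizon_sizes {b : ℝ} (he : 12499 ≤ Real.exp (2 * b)) (he' : Real.exp (2 * b) ≤ 25000) :
    Real.exp 1 ≤ dodgerT₀ b ∧ 17.07 * Real.exp (2 * b) ≤ dodgerT₀ b ∧ dodgerT₀ b ≤ 17.08 * Real.exp (2 * b) ∧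
      213300 ≤ dodgerT₀ b ∧ dodgerT₀ b ≤ 427000 ∧
      10 ≤ (0.1038 * Real.log (dodgerT₀ b) + 0.2573 * Real.log (Real.log (dodgerT₀ b)) + 9.3675) ∧
      (0.1038 * Real.log (dodgerT₀ b) + 0.2573 * Real.log (Real.log (dodgerT₀ b)) + 9.3675) ≤ 11.52 := by
  obtain ⟨hb0, hb1⟩ := slabThree_b_bounds he he'
  have hπ3 : 3.1415 < π := Real.pi_gt_d4
  have hπ4 : π < 3.1416 := Real.pi_lt_d4
  have hegt := Real.exp_one_gt_d9
  have helt := Real.exp_one_lt_d9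
  set T₀ := dodgerT₀ b with hT₀
  have hTe : T₀ = 2 * π * Real.exp 1 * Real.exp (2 * b) := by
    rw [hT₀, dodgerT₀, Real.exp_add]; ring
  have hc1 : (17.07 : ℝ) ≤ 2 * π * Real.exp 1 := by nlinarith only [hπ3, hegt]
  have hc2 : 2 * π * Real.exp 1 ≤ 17.08 := by nlinarith only [hπ4, helt, hπ3, hegt]
  have hlo : 17.07 * Real.exp (2 * b) ≤ T₀ := by rw [hTe]; exact mul_le_mul_of_nonneg_right hc1 (Real.exp_pos _).le
  have hhi : T₀ ≤ 17.08 * Real.exp (2 * b) := by rw [hTe]; exact mul_le_mul_of_nonneg_right hc2 (Real.exp_pos _).le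
  have hT₀lo : 213300 ≤ T₀ := by linarith only [hlo, he]
  have hT₀hi : T₀ ≤ 427000 := by linarith only [hhi, he']
  have hT₀e : Real.exp 1 ≤ T₀ := by linarith only [hT₀lo, helt]
  have hT₀pos : 0 < T₀ := lt_of_lt_of_le (Real.exp_pos 1) hT₀e
  have hlog : Real.log T₀ = Real.log (2 * π) + 1 + 2 * b := by
    rw [hT₀, dodgerT₀, Real.log_mul (by positivity) (Real.exp_pos _).ne', Real.log_exp]; ring
  have hl2π0 : 0 ≤ Real.log (2 * π) := Real.log_nonneg (by linarith)
  have hl2π2 : Real.log (2 * π) ≤ 2 := by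
    have h72 := exp_numerics.2.1
    have : 2 * π ≤ Real.exp 2 := by linarith
    calc Real.log (2 * π) ≤ Real.log (Real.exp 2) := Real.log_le_log (by positivity) this
      _ = 2 := Real.log_exp 2
  have hlogT₀ge : 2 * b + 1 ≤ Real.log T₀ := by rw [hlog]; linarith
  have hlogT₀le : Real.log T₀ ≤ 2 * b + 3 := by rw [hlog]; linarith
  have hlogT₀1 : 1 ≤ Real.log T₀ := by linarith
  have hll0 : 0 ≤ Real.log (Real.log T₀) := Real.log_nonneg hlogT₀1
  -- `log log T₀ ≤ 2.7` since `log T₀ ≤ 14.004 ≤ e^{2.7}`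
  have hll : Real.log (Real.log T₀) ≤ 2.7 := by
    have h27 : (14.35 : ℝ) ≤ Real.exp 2.7 := by
      have e1 : Real.exp 2.7 = Real.exp 2 * Real.exp 0.7 := by rw [← Real.exp_add]; norm_num
      have h7 : (1.945 : ℝ) ≤ Real.exp 0.7 := by
        have := Real.quadratic_le_exp_of_nonneg (show (0 : ℝ) ≤ 0.7 by norm_num); norm_num at this; linarith
      have h2 := exp_numerics.2.1
      rw [e1]; nlinarith only [h2, h7, Real.exp_pos (0.7 : ℝ)]
    have : Real.log T₀ ≤ Real.exp 2.7 := by linarith only [hlogT₀le, hb1, h27]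
    calc Real.log (Real.log T₀) ≤ Real.log (Real.exp 2.7) := Real.log_le_log (by linarith) this
      _ = 2.7 := Real.log_exp _
  refine ⟨hT₀e, hlo, hhi, hT₀lo, hT₀hi, by nlinarith only [hlogT₀ge, hll0, hb0], by nlinarith only [hlogT₀le, hll, hb1]⟩

/-- On the slab: the two clean-horizon side conditions `T₀ ≤ (11/10)T*` and `s + 1 ≤ (14/2π)log(T₀/14)`.
[this track, ATTEMPT-16 (Q1a)(Q1b); ATTEMPT-23 §2] -/
theorem slabThree_horizon_side_conditions {b : ℝ} (he : 12499 ≤ Real.exp (2 * b)) (he' : Real.exp (2 * b) ≤ 25000) :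
    dodgerT₀ b ≤ 11 / 10 * (dodgerT₀ b - 4 * π * ((0.1038 * Real.log (dodgerT₀ b) + 0.2573 * Real.log (Real.log (dodgerT₀ b)) + 9.3675) + 2)) ∧
    (0.1038 * Real.log (dodgerT₀ b) + 0.2573 * Real.log (Real.log (dodgerT₀ b)) + 9.3675) + 1 ≤ 14 / (2 * π) * Real.log (dodgerT₀ b / 14) := by
  obtain ⟨hb0, hb1⟩ := slabThree_b_bounds he he'
  obtain ⟨hT₀e, hT₀ge, -, hT₀lo, -, hs9, hsb⟩ := slabThree_horizon_sizes he he'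
  have hπ3 : 3 < π := Real.pi_gt_three
  have hπ4 : π < 3.1416 := Real.pi_lt_d4
  set T₀ := dodgerT₀ b with hT₀
  set s := (0.1038 * Real.log (dodgerT₀ b) + 0.2573 * Real.log (Real.log (dodgerT₀ b)) + 9.3675) with hs
  have hT₀pos : 0 < T₀ := lt_of_lt_of_le (Real.exp_pos 1) hT₀e
  have h4πs : 4 * π * (s + 2) ≤ 170 := by nlinarith only [hπ4, hsb, hs9, hπ3]
  constructor
  · nlinarith only [h4πs, hT₀lo]
  · have hlog : Real.log (T₀ / 14) = Real.log (2 * π) + 1 + 2 * b - Real.log 14 := by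
      rw [Real.log_div hT₀pos.ne' (by norm_num), hT₀, dodgerT₀, Real.log_mul (by positivity) (Real.exp_pos _).ne', Real.log_exp]
      ring
    have hl2π0 : 0 ≤ Real.log (2 * π) := Real.log_nonneg (by linarith)
    have hl14 : Real.log 14 ≤ 3 := by
      rw [show (14 : ℝ) = 2 * 7 by norm_num, Real.log_mul (by norm_num) (by norm_num)]
      have h2 : Real.log 2 < 0.6931471808 := Real.log_two_lt_d9
      have h7 : Real.log 7 ≤ 2 := by
        have := Real.log_le_sub_one_of_pos (show (0:ℝ) < 7 / Real.exp 2 by positivity)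
        rw [Real.log_div (by norm_num) (Real.exp_pos 2).ne', Real.log_exp] at this
        have he : 7 / Real.exp 2 ≤ 1 := by
          rw [div_le_one (Real.exp_pos 2)]
          linarith [exp_numerics.2.1]
        linarith
      linarith
    rw [hlog]
    have h14 : (2.2 : ℝ) ≤ 14 / (2 * π) := by rw [le_div_iff₀ (by positivity)]; linarith
    have hpos : 0 ≤ Real.log (2 * π) + 1 + 2 * b - Real.log 14 := by linarith
    calc s + 1 ≤ 2.2 * (Real.log (2 * π) + 1 + 2 * b - Real.log 14) := by nlinarith only [hsb, hl2π0, hl14, hb0]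
      _ ≤ 14 / (2 * π) * (Real.log (2 * π) + 1 + 2 * b - Real.log 14) := mul_le_mul_of_nonneg_right h14 hpos

/-- On the slab: the lattice index `k′` satisfies `T* − π/b ≤ πk′/b ≤ T*`, `3 ≤ πk′/b`, `2 ≤ k′`,
`2 ≤ πk′/b − π(3s+5)/b`, `1 ≤ k′ − 3s − 5`, and `πk′/b ≤ T₀`. [this track, ATTEMPT-16 §1; ATTEMPT-23 §2] -/
theorem slabThree_horizon_index_bounds {b : ℝ} (he : 12499 ≤ Real.exp (2 * b)) (he' : Real.exp (2 * b) ≤ 25000) :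
    π * (dodgerKprime b) / b ≤ dodgerTstar b ∧
    dodgerTstar b - π / b ≤ π * (dodgerKprime b) / b ∧
    3 ≤ π * (dodgerKprime b) / b ∧ 2 ≤ dodgerKprime b ∧
    2 ≤ π * (dodgerKprime b) / b - π * (3 * (0.1038 * Real.log (dodgerT₀ b) + 0.2573 * Real.log (Real.log (dodgerT₀ b)) + 9.3675) + 5) / b ∧
    1 ≤ (dodgerKprime b : ℝ) - 3 * (0.1038 * Real.log (dodgerT₀ b) + 0.2573 * Real.log (Real.log (dodgerT₀ b)) + 9.3675) - 5 ∧
    π * (dodgerKprime b) / b ≤ dodgerT₀ b := by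
  obtain ⟨hb0, hb1⟩ := slabThree_b_bounds he he'
  obtain ⟨hT₀e, hT₀ge, -, hT₀lo, -, hs9, hsb⟩ := slabThree_horizon_sizes he he'
  have hπ3 : 3 < π := Real.pi_gt_three
  have hπ4 : π < 3.1416 := Real.pi_lt_d4
  have hπ := Real.pi_pos
  have hb00 : 0 < b := by linarith
  set T₀ := dodgerT₀ b with hT₀
  set s := (0.1038 * Real.log (dodgerT₀ b) + 0.2573 * Real.log (Real.log (dodgerT₀ b)) + 9.3675) with hs
  have hTs : dodgerTstar b = T₀ - 4 * π * (s + 2) := rfl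
  set Ts := dodgerTstar b with hTsdef
  have h4πs : 4 * π * (s + 2) ≤ 170 := by nlinarith only [hπ4, hsb, hs9, hπ3]
  have hTsbig : 213100 ≤ Ts := by rw [hTs]; linarith only [h4πs, hT₀lo]
  have hTspos : 0 < Ts := by linarith
  -- the floor
  have hx0 : 0 ≤ b * Ts / π := by positivity
  have hk1 : ((dodgerKprime b : ℕ) : ℝ) ≤ b * Ts / π := Nat.floor_le hx0
  have hk2 : b * Ts / π - 1 ≤ ((dodgerKprime b : ℕ) : ℝ) := by
    have := Nat.lt_floor_add_one (b * Ts / π); rw [dodgerKprime]; linarith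
  have hA : π * (dodgerKprime b) / b ≤ Ts := by
    rw [div_le_iff₀ hb00]
    have := mul_le_mul_of_nonneg_left hk1 hπ.le
    rw [mul_div_assoc', mul_comm π (b * Ts), mul_div_assoc, div_self hπ.ne', mul_one] at this
    linarith
  have hB : Ts - π / b ≤ π * (dodgerKprime b) / b := by
    rw [le_div_iff₀ hb00, sub_mul, div_mul_cancel₀ _ hb00.ne']
    have := mul_le_mul_of_nonneg_left hk2 hπ.le
    rw [mul_sub, mul_one, mul_div_assoc', mul_comm π (b * Ts), mul_div_assoc, div_self hπ.ne', mul_one] at this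
    linarith
  have hπb : π / b ≤ 1 := by rw [div_le_one hb00]; linarith
  have hπsb : π * (3 * s + 5) / b ≤ 27 := by
    rw [div_le_iff₀ hb00]; nlinarith only [hπ4, hsb, hs9, hπ3, hb0]
  have hkr : Ts - 1 ≤ ((dodgerKprime b : ℕ) : ℝ) := by
    have : b * Ts / π ≥ Ts := by
      rw [ge_iff_le, le_div_iff₀ hπ]; nlinarith only [hb0, hπ4, hTspos]
    linarith
  refine ⟨hA, hB, by linarith, ?_, by linarith, by linarith only [hkr, hsb, hTsbig], ?_⟩
  · have : (2 : ℝ) ≤ ((dodgerKprime b : ℕ) : ℝ) := by linarith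
    exact_mod_cast this
  · have : Ts ≤ T₀ := by rw [hTs]; nlinarith only [hπ3, hs9]
    linarith

/-- **Part (1) of the third-slab discharge.** On `12499 ≤ e^{2b} ≤ 25000`: `T₀ ≤ 1.01T′`, `T′ ≤ T₀`, `e^{2b} ≤ T′`,
`213000 ≤ T′ ≤ 427000`, `T′³/56.7 ≤ cI ≤ T′³`, `1024 ≤ 4cI`, `T′³/28.36 ≤ pL`, `0 < pU ≤ 1.615·T′³`, `T′² ≤ W ≤ 1.01T′²`,
`W ≤ T′² + 1/4`, `2 ≤ k′ ≤ 0.3184·b·T′`, `17.05e^{2b} ≤ T′`. [this track, ATTEMPT-23 §7] -/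
theorem slabThree_horizon_sizes_B {b : ℝ} (he : 12499 ≤ Real.exp (2 * b)) (he' : Real.exp (2 * b) ≤ 25000) :
    dodgerT₀ b ≤ 101 / 100 * dodgerTprime b ∧ dodgerTprime b ≤ dodgerT₀ b ∧ Real.exp (2 * b) ≤ dodgerTprime b ∧
    213000 ≤ dodgerTprime b ∧ dodgerTprime b ≤ 427000 ∧
    dodgerTprime b ^ 3 / 56.7 ≤ dodgerCI b ∧ dodgerCI b ≤ dodgerTprime b ^ 3 ∧ 1024 ≤ 4 * dodgerCI b ∧
    dodgerTprime b ^ 3 / 28.36 ≤ dodgerPL b ∧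
    0 < dodgerPU b ∧ dodgerPU b ≤ 1.615 * dodgerTprime b ^ 3 ∧
    dodgerTprime b ^ 2 ≤ dodgerW b ∧ dodgerW b ≤ 101 / 100 * dodgerTprime b ^ 2 ∧ dodgerW b ≤ dodgerTprime b ^ 2 + 1 / 4 ∧
    (2 : ℝ) ≤ (dodgerKprime b : ℝ) ∧ (dodgerKprime b : ℝ) ≤ 0.3184 * b * dodgerTprime b ∧
    17.05 * Real.exp (2 * b) ≤ dodgerTprime b := by
  obtain ⟨hb0, hb1⟩ := slabThree_b_bounds he he'
  obtain ⟨hT₀e, hT₀ge, hT₀le, hT₀lo, hT₀hi, hs9, hsb⟩ := slabThree_horizon_sizes he he'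
  obtain ⟨hA, hB, hT3, hk2, hℓ2, hK1, hAT₀⟩ := slabThree_horizon_index_bounds he he'
  have hπ3 : 3 < π := Real.pi_gt_three
  have hπ4 : π < 3.1416 := Real.pi_lt_d4
  have hπ := Real.pi_pos
  have hb00 : 0 < b := by linarith
  set T₀ := dodgerT₀ b with hT₀
  set s := (0.1038 * Real.log (dodgerT₀ b) + 0.2573 * Real.log (Real.log (dodgerT₀ b)) + 9.3675 : ℝ) with hs
  have hTs : dodgerTstar b = T₀ - 4 * π * (s + 2) := rfl
  rw [hTs] at hA hB
  have hT'def : dodgerTprime b = π * (dodgerKprime b) / b := rfl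
  set T' := dodgerTprime b with hT'
  rw [← hT'def] at hA hB hT3 hℓ2 hAT₀
  set k : ℝ := (dodgerKprime b : ℝ) with hk
  have hπb : π / b ≤ 1 := by rw [div_le_one hb00]; linarith
  have h4πs : 4 * π * (s + 2) ≤ 170 := by nlinarith only [hπ4, hsb, hs9, hπ3]
  -- `T′ ≥ T₀ − 4π(s+2) − π/b ≥ 17.07e^{2b} − 171 ≥ 17.05e^{2b}`
  have hT'lo : 17.07 * Real.exp (2 * b) - 171 ≤ T' := by linarith only [hB, hπb, h4πs, hT₀ge]
  have hT'17 : 17.05 * Real.exp (2 * b) ≤ T' := by linarith only [hT'lo, he]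
  have hT'big : 213000 ≤ T' := by linarith only [hT'17, he]
  have hT'pos : 0 < T' := by linarith only [hT'big]
  have hexp2b : Real.exp (2 * b) ≤ T' := by linarith only [hT'17, he]
  have hT'hi : T' ≤ 427000 := hAT₀.trans hT₀hi
  -- `T₀ ≤ 1.01 T′`
  have h101 : T₀ ≤ 101 / 100 * T' := by linarith only [hB, hπb, h4πs, hT'big]
  -- `k′ = bT′/π ≤ 0.3184 b T′`
  have hkT : k = b * T' / π := by rw [hT'def]; field_simp
  have hk04 : k ≤ 0.3184 * b * T' := by
    rw [hkT, div_le_iff₀ hπ]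
    have := mul_nonneg hb00.le hT'pos.le
    nlinarith only [this, Real.pi_gt_d4]
  have hk0 : 0 ≤ k := by rw [hk]; exact Nat.cast_nonneg _
  have hkT' : k ≤ 1.615 * T' := by nlinarith only [hk04, hb1, hT'pos]
  -- `cI ≥ T′³/56.7`
  have hlogT₀ : Real.log T₀ ≤ 2 * b + 3 := by
    have e1 : Real.log T₀ = Real.log (2 * π) + 1 + 2 * b := by
      rw [hT₀, dodgerT₀, Real.log_mul (by positivity) (Real.exp_pos _).ne', Real.log_exp]; ring
    have hl2π2 : Real.log (2 * π) ≤ 2 := by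
      have h72 := exp_numerics.2.1
      have : 2 * π ≤ Real.exp 2 := by linarith
      calc Real.log (2 * π) ≤ Real.log (Real.exp 2) := Real.log_le_log (by positivity) this
        _ = 2 := Real.log_exp 2
    linarith only [e1, hl2π2]
  have hlogT₀0 : 0 ≤ Real.log T₀ := by
    have : (1:ℝ) ≤ T₀ := by have := Real.exp_one_gt_d9; linarith only [this, hT₀e]
    exact Real.log_nonneg this
  have hps : π * (3 * s + 5) / b + 1 ≤ 28 := by
    have : π * (3 * s + 5) / b ≤ 27 := by
      rw [div_le_iff₀ hb00]; nlinarith only [hπ4, hsb, hs9, hπ3, hb0]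
    linarith only [this]
  have hps0 : 0 ≤ π * (3 * s + 5) / b + 1 := by
    have : 0 ≤ π * (3 * s + 5) / b := div_nonneg (by nlinarith only [hπ, hs9]) hb00.le
    linarith only [this]
  -- `(T′ − a)³ ≥ T′³ − 3aT′²` for `0 ≤ a ≤ 28`
  have hcube : T' ^ 3 - 84 * T' ^ 2 ≤ (T' - π * (3 * s + 5) / b - 1) ^ 3 := by
    have e : T' - π * (3 * s + 5) / b - 1 = T' - (π * (3 * s + 5) / b + 1) := by ring
    rw [e]
    set a := π * (3 * s + 5) / b + 1 with ha
    have h1 : 0 ≤ (28 - a) * T' ^ 2 := mul_nonneg (by linarith only [hps]) (sq_nonneg _)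
    have h2 : 0 ≤ a ^ 2 * (3 * T' - a) := mul_nonneg (sq_nonneg _) (by linarith only [hps, hT'big])
    nlinarith only [h1, h2]
  have hsq : (s + 1) * (T' - 1) ^ 2 / 2 ≤ 6.26 * T' ^ 2 := by
    have h2 : (T' - 1) ^ 2 ≤ T' ^ 2 := by nlinarith only [hT'big]
    have h3 : (s + 1) * (T' - 1) ^ 2 ≤ 12.52 * T' ^ 2 :=
      mul_le_mul (by linarith only [hsb]) h2 (sq_nonneg _) (by norm_num)
    linarith only [h3]
  have hcI : T' ^ 3 / 56.7 ≤ dodgerCI b := by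
    rw [dodgerCI, ← hT', ← hs, ← hT₀]
    have h4 : (Real.log T₀ + 1 / 3) / (6 * π) ≤ 1 := by
      rw [div_le_iff₀ (by positivity)]; nlinarith only [hπ3, hlogT₀, hb1]
    have h5 : (T' ^ 3 - 84 * T' ^ 2) / (18 * π) ≤ (T' - π * (3 * s + 5) / b - 1) ^ 3 / (18 * π) :=
      div_le_div_of_nonneg_right hcube (by positivity)
    have h6 : (T' ^ 3 - 84 * T' ^ 2) / 56.5488 ≤ (T' ^ 3 - 84 * T' ^ 2) / (18 * π) :=
      div_le_div_of_nonneg_left (by nlinarith only [hT'big]) (by positivity) (by nlinarith only [hπ4])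
    have key : T' ^ 3 / 56.7 + 1 + 6.26 * T' ^ 2 ≤ (T' ^ 3 - 84 * T' ^ 2) / 56.5488 := by
      rw [div_add' _ _ _ (by norm_num), div_add' _ _ _ (by norm_num), div_le_div_iff₀ (by norm_num) (by norm_num)]
      nlinarith only [hT'big, sq_nonneg T']
    linarith only [key, h4, h5, h6, hsq]
  have hcI2 : dodgerCI b ≤ T' ^ 3 := by
    rw [dodgerCI, ← hT', ← hs, ← hT₀]
    have hc3 : (T' - π * (3 * s + 5) / b - 1) ^ 3 ≤ T' ^ 3 :=
      pow_le_pow_left₀ (by linarith only [hps, hT'big]) (by linarith only [hps0]) 3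
    have h1 : (T' - π * (3 * s + 5) / b - 1) ^ 3 / (18 * π) ≤ T' ^ 3 / (18 * π) :=
      div_le_div_of_nonneg_right hc3 (by positivity)
    have h2 : T' ^ 3 / (18 * π) ≤ T' ^ 3 := by
      rw [div_le_iff₀ (by positivity)]; nlinarith only [pow_pos hT'pos 3, hπ3]
    have hX : 0 ≤ (Real.log T₀ + 1 / 3) / (6 * π) := div_nonneg (by linarith only [hlogT₀0]) (by positivity)
    have hY : 0 ≤ (s + 1) * (T' - 1) ^ 2 / 2 :=
      div_nonneg (mul_nonneg (by linarith only [hs9]) (sq_nonneg _)) (by norm_num)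
    linarith only [h1, h2, hX, hY]
  have hcL : 1024 ≤ 4 * dodgerCI b := by
    have : T' ^ 3 / 56.7 ≥ 256 := by
      rw [ge_iff_le, le_div_iff₀ (by positivity)]
      nlinarith only [pow_le_pow_left₀ (by norm_num : (0:ℝ) ≤ 213000) hT'big 3]
    linarith only [this, hcI]
  have hpL : T' ^ 3 / 28.36 ≤ dodgerPL b := by
    rw [dodgerPL, ← hk]
    have h4 : k / 4 ≤ 0.404 * T' := by linarith only [hkT', hT'pos]
    have h3 : 2 * (T' ^ 3 / 56.7) - T' ^ 3 / 28.36 ≥ 0.404 * T' := by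
      have e : 2 * (T' ^ 3 / 56.7) - T' ^ 3 / 28.36 = T' ^ 3 * (2 / 56.7 - 1 / 28.36) := by ring
      rw [e, ge_iff_le]
      have p2 : (213000 : ℝ) ^ 2 ≤ T' ^ 2 := pow_le_pow_left₀ (by norm_num) hT'big 2
      nlinarith only [p2, hT'pos]
    linarith only [h3, h4, hcI]
  have hW : dodgerW b ≤ 101 / 100 * T' ^ 2 := by
    rw [dodgerW, ← hT']; nlinarith only [hT'big]
  have hW1 : T' ^ 2 ≤ dodgerW b := by rw [dodgerW, ← hT']; linarith only []
  have hW3 : dodgerW b ≤ T' ^ 2 + 1 / 4 := by rw [dodgerW, ← hT']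
  have hk2' : (2 : ℝ) ≤ k := by rw [hk]; exact_mod_cast hk2
  have hpU : dodgerPU b ≤ 1.615 * T' ^ 3 := by
    rw [dodgerPU, ← hk]
    have hW0 : 0 ≤ dodgerW b := by rw [dodgerW]; positivity
    calc k * dodgerW b ≤ 0.3184 * b * T' * (T' ^ 2 + 1 / 4) := mul_le_mul hk04 hW3 hW0 (by positivity)
      _ ≤ 1.615 * T' ^ 3 := by nlinarith only [hb1, hb0, hT'big, pow_pos hT'pos 3]
  have hpU0 : 0 < dodgerPU b := by
    rw [dodgerPU, ← hk]; exact mul_pos (by linarith only [hk2']) (by rw [dodgerW]; positivity)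
  exact ⟨h101, hAT₀, hexp2b, hT'big, hT'hi, hcI, hcI2, hcL, hpL, hpU0, hpU, hW1, hW, hW3, hk2', hk04, hT'17⟩

end Summit.RiemannHypothesis.RiemannHypothesis.Theorems.Handoff

end
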